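import Summits.KontsevichZagierPeriods.KontsevichZagierPeriods.Theses.LinkTwistWrithe
import Literature.NumberTheory.Transcendental.KZVolumeConjectureProofs

/-!
# `DegreeKernel` (stmt-KontsevichZagierPeriods-4303, route LinkTwistWrithe, auto-crux rank 0) — birth skeleton

Crux (the route's TARGET, auto-promoted to crux as an underived hypothesis of `closes`; Conjecture 1
of KontsevichZagier2001 §1.2 in KERNEL FORM for the calculus ENLARGED by signed-degree relators):
`∀ c : KZ.FormalRep, KZ.eval c = 0 → c ∈ R'`, where
`R' = AddSubgroup.closure (domainAddRel ∪ integrandAddRel ∪ newtonLeibnizRel ∪ degreeRel)` and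
`degreeRel` (below, verbatim from the crux) is the set of relators `[⋃σ_k, Σ_k ε_k 1_{σ_k}(g∘Φ_k)|det Φ_k′|] − d•[τ, g]`
of finite signed sheet families with a.e.-constant signed count `d` (rule (2) = the one-sheet
relators). Honest status (route header, refuter/grounder notes on the item): GPC-strength —
equivalent to `Literature.NumberTheory.Transcendental.KZKernelConjecture` modulo `DegreeTransfer`
(stmt-4306) and one-sheet absorption.

Line `birth` = THE VOLUME FORM WITH FOLDS. Cresson–Viu-Sos' geometric reading of Conjecture 1
("volume is the only KZ-invariant of compact top-dimensional semialgebraic bodies",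
CressonViusos2022 §1 p. 326; in the tree `KZ.volumeConjectureCompact`, proved equivalent to
Conjecture 1 through Viu-Sos' semi-canonical reduction, `KZ.semiCanonicalReduction_holds` /
`KZ.kzPeriodConjecture'_iff_volumeConjectureCompact_holds`) is pointed at the ENLARGED calculus,
where the route's engine is load-bearing: the catalogued obstruction to relating two equal-volume
bodies by ONE global semialgebraic map is the semialgebraic Hauptvermutung
(`Literature.Barriers.KontsevichZagierPeriods.cressonViuSos_prop_3_2`, CressonViusos2022 Prop. 3.2:
homeomorphic, not PL-homeomorphic rational polyhedra admit no volume-preserving semialgebraic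
HOMEOMORPHISM), and a signed-degree relator is a FOLDED, many-sheeted, signed map — not a
homeomorphism — so the GKZ-type moves (CressonViusos2022 Conj. 1.1: scissors + volume-preserving
algebraic maps + products) acquire exactly the flexibility the barrier denies. Two named pieces over
existing declarations (`Literature.NumberTheory.Transcendental.KZ.*`, Mathlib) and the local
abbreviations `degreeRel ⊆ enlargedGens`, `enlargedRelations = R'`:

* `stub_oneSheet` (PROVABLE NOW, size M): `KZ.changeOfVariablesRel ⊆ degreeRel` — rule (2) IS the
  signed-degree relator with one sheet `σ 0 = r.domain`, weight `1`, count `1` (the route header's "a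
  rule-2 instance is the one-sheet relator"; the refuter's route-review note). Consequence (proved
  below): `KZ.relations ≤ R'`, the enlarged calculus extends KZ's.
* `stub_foldedVolumeKernel` (OPEN; the VOLUME KERNEL OF THE FOLDED CALCULUS): two compact
  top-dimensional `ℚ`-semialgebraic bodies of one dimension with equal volume, as integrand-`1`
  representations `A`, `B`, have `[A] − [B] ∈ R'`. For KZ's own calculus this is
  `KZ.volumeConjectureCompact` (⇔ summit, landed); with target `R' ⊇ relations` it is implied by the
  summit given stub 1 and implied by the crux outright (folder `bc/converse.lean`, sorry-free), and it
  is the weakest open piece on any road to the crux through volumes. Why it might fail: GPC-strength —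
  an additive invariant of `FormalRep` killing (1a), (1b), (3) and every signed-degree relator yet
  separating two equal-volume bodies (= ¬summit through `closes`); none is known.

Composition (sorry-free, `degreeKernel_of_stubs`, axioms propext/Classical.choice/Quot.sound): given
`eval c = 0`, `c ≡ [r] − [r']` modulo KZ relations (`KZ.exists_integralRep_sub_holds`) and
`value r = value r'` by soundness (`KZ.relations_le_ker_eval_holds`); Viu-Sos (LANDED,
`KZ.IntegralRep.exists_sub_volumeRep_mem_relations_of_semiCanonicalReduction
KZ.semiCanonicalReduction_holds`) writes `[r] ≡ [A] − [B]`, `[r'] ≡ [A'] − [B']` with volume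
representations; raise the four to one dimension (`exists_volumeRep_equivalent_of_le`), glue
`M₁ ≡ [A] + [B']`, `M₂ ≡ [A'] + [B]` (`exists_volumeRep_of_add_sub_of_mem_relations`);
`vol M₁ = vol M₂` by soundness; stub 2 gives `[M₁] − [M₂] ∈ R'`; every KZ relation met on the way
lies in `R'` by stub 1; bookkeeping in the free abelian group (`abel`) returns `c ∈ R'`. This is the
tree's `KZ.kzPeriodConjecture'_of_volumeConjectureCompact` re-targeted at `R'` and composed with the
kernel/two-representation bookkeeping of `KZKernelConjecture.of_kzPeriodConjecture'`.
`DegreeKernel_of : DegreeKernel` feeds the two stubs in BY NAME through `degreeKernel_iff`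
(`Iff.rfl`: the crux is literally the kernel statement for `R'`); the arrow form concludes the
unfolded statement, so exactly one theorem of this file concludes the crux by name
(`#h21_check_skeleton` admits no inline `Prop` hypotheses).

Rejected cuts (registrar's census): `KZKernelConjecture` or the two-representation form for `R'` as
a stub — COSTUME (landed iffs `kzKernelConjecture_iff_isRational`,
`kzKernelConjecture_iff_kzPeriodConjecture'`; the port is bookkeeping); a dimension split of the
volume kernel — the `d ≥ 3` piece gives the rest through unit slabs (`IntegralRep.equivalent_slab`)
and reduction to LOWER dimension is false (`π` is an area, never a length of a compact
`ℚ`-semialgebraic subset of `ℝ`); "folded Moser" (ONE signed sheet family between any two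
equal-volume bodies, i.e. `[A] − 1•[B] ∈ degreeRel` after scissors) — the line's sharper geometric
question, too speculative to register (recorded in `Lines/birth.md`); `DegreeKernel ⇐ MultiCoVKernel`
(stmt-2873: its unsigned sheet relators are signed-degree relators with `ε ≡ 1`, co-null images,
`d = N`, so `R⁺ ≤ R'`) — true and cheap, recorded as a dedup edge for planners, not this line.

Disproof used: none on file (no `Cruxes/DegreeKernel/Disproof.lean`, no dead lines, no Negative
lemmas; `ledger negatives --problem KontsevichZagierPeriods` = one unrelated statement,
KinematicFormulas 5394). BC3 probes (folder `bc/probe_*.lean`): for each stub, `stub → DegreeKernel`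
and `stub → KontsevichZagierPeriods` by `first | exact? | simpa | aesop` (and five further variants)
all FAIL — see `Lines/birth.md`.
-/

set_option linter.dupNamespace false

noncomputable section

namespace Summit.KontsevichZagierPeriods.KontsevichZagierPeriods.Cruxes.DegreeKernel.Birth

open Summit.KontsevichZagierPeriods.KontsevichZagierPeriods.Theses.LinkTwistWrithe (DegreeKernel)
open Literature.NumberTheory.Transcendental

/-! ## The enlarged calculus (verbatim from the crux) -/

/-- The SIGNED-DEGREE RELATORS — the fourth generating set of the route's enlarged calculus,
copied verbatim from the body of `DegreeKernel`: for a finite family of `ℚ`-semialgebraic sheets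
`σ k ⊆ r.domain` (co-null union), injective differentiable `ℚ`-semialgebraic maps `Φ k` on them into
`r'.domain` with integer weights `ε k` whose signed sheet count is a.e. the integer `d` on
`r'.domain`, and the integrand identity `r.integrand = Σ_k 1_{σ k} · ε k · (r'.integrand ∘ Φ k) · |det Φ' k|`
on `⋃ σ k`, the relator `[r] − d • [r']`. [cite: KontsevichZagier2001, §1.2 rule (2)] -/
def degreeRel : Set KZ.FormalRep :=
  {c | ∃ (n N : ℕ) (d : ℤ) (ε : Fin N → ℤ) (r r' : Literature.NumberTheory.Transcendental.KZ.IntegralRep n) (σ : Fin N → Set (Fin n → ℝ)) (Φ : Fin N → (Fin n → ℝ) → (Fin n → ℝ)) (Φ' : Fin N → (Fin n → ℝ) → ((Fin n → ℝ) →L[ℝ] (Fin n → ℝ))), (∀ k, Literature.ModelTheory.ExponentialFields.IsSemialgebraic ℚ (σ k)) ∧ (∀ k, σ k ⊆ r.domain) ∧ MeasureTheory.volume (r.domain \ ⋃ k, σ k) = 0 ∧ (∀ k, Literature.NumberTheory.Transcendental.IsSemialgebraicMapOn ℚ (σ k) (Φ k)) ∧ (∀ k, ∀ x ∈ σ k,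 HasFDerivWithinAt (Φ k) (Φ' k x) (σ k) x) ∧ (∀ k, Set.InjOn (Φ k) (σ k)) ∧ (∀ k, Φ k '' σ k ⊆ r'.domain) ∧ (∀ᵐ y ∂(MeasureTheory.volume.restrict r'.domain), (∑ k : Fin N, (Φ k '' σ k).indicator (fun _ => ε k) y) = d) ∧ (∀ x ∈ ⋃ k, σ k, r.integrand x = ∑ k : Fin N, (σ k).indicator (fun y => (ε k : ℝ) * (r'.integrand (Φ k y) * |(Φ' k y).det|)) x) ∧ c = Literature.NumberTheory.Transcendental.KZ.of r - d • Literature.NumberTheory.Transcendental.KZ.of r'}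

/-- The generators of the ENLARGED calculus of the route: domain additivity (1a), integrand
additivity (1b), Newton–Leibniz (3) and the signed-degree relators (rule (2) being their one-sheet
instances). [cite: KontsevichZagier2001, §1.2] -/
def enlargedGens : Set KZ.FormalRep :=
  KZ.domainAddRel ∪ KZ.integrandAddRel ∪ KZ.newtonLeibnizRel ∪ degreeRel

/-- The relation subgroup `R'` of the enlarged calculus. [cite: KontsevichZagier2001, §1.2] -/
def enlargedRelations : AddSubgroup KZ.FormalRep :=
  AddSubgroup.closure enlargedGens

/-- The crux, unfolded: `DegreeKernel` is literally the kernel conjecture for `R'`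
(definitional, `Iff.rfl`). [cite: KontsevichZagier2001, §1.2 Conjecture 1] -/
theorem degreeKernel_iff :
    DegreeKernel ↔ ∀ c : KZ.FormalRep, KZ.eval c = 0 → c ∈ enlargedRelations :=
  Iff.rfl

/-! ## The two stubs -/

/-- Stub 1 — RULE (2) IS THE ONE-SHEET SIGNED-DEGREE RELATOR (provable now, size M): every
change-of-variables relator `[r] − [r']` (`Φ` `ℚ`-semialgebraic, injective and differentiable
within `r.domain`, `r'.domain = Φ '' r.domain`, `r.integrand = (r'.integrand ∘ Φ)·|det Φ'|`) is the
signed-degree relator with ONE sheet `σ 0 = r.domain`, weight `ε 0 = 1` and count `d = 1`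
(the count is `1` on `r'.domain = Φ '' σ 0` everywhere, a fortiori a.e.; `(1 : ℤ) • [r'] = [r']`).
This is the route header's sentence "a rule-2 instance is the one-sheet relator" and the refuter's
route-review note (closure(1a ∪ 1b ∪ 3 ∪ Deg) ⊇ KZ.relations); with it `KZ.relations ≤ R'`.
Why it might fail: only as typed (a side condition of `degreeRel` not met by the rule-(2) data —
none is: measurability of `r'.domain` for the a.e. statement is
`KZ.IntegralRep.measurableSet_domain_holds`). Sources: KontsevichZagier2001 §1.2 rule (2);
`Literature.NumberTheory.Transcendental.KZ.changeOfVariablesRel`. -/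
theorem stub_oneSheet : KZ.changeOfVariablesRel ⊆ degreeRel := by
  sorry

/-- Stub 2 — THE VOLUME KERNEL OF THE FOLDED CALCULUS (open; Cresson–Viu-Sos' volume form of
Conjecture 1, posed for the ENLARGED calculus): two compact top-dimensional (= non-empty interior)
`ℚ`-semialgebraic bodies `A, B ⊂ ℝ^d` of equal volume, read as integrand-`1` representations, have
`[A] − [B] ∈ R'`. For KZ's own calculus this is `KZ.volumeConjectureCompact`, printed EQUIVALENT to
Conjecture 1 [CressonViusos2022 §1 p. 326] and proved equivalent in the tree
(`KZ.kzPeriodConjecture'_iff_volumeConjectureCompact_holds`, through Viu-Sos' semi-canonical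
reduction `KZ.semiCanonicalReduction_holds`); here the target group is `R' ⊇ relations`, so the
statement is implied by the summit (given stub 1) and is where the route's engine bites: the
catalogued obstruction to passing between equal-volume bodies by ONE global semialgebraic map is the
semialgebraic Hauptvermutung (`Literature.Barriers.KontsevichZagierPeriods.cressonViuSos_prop_3_2`:
no volume-preserving semialgebraic HOMEOMORPHISM between certain equal-volume polyhedra), and a
signed-degree relator is a FOLDED many-sheeted map, not a homeomorphism. Why it might fail:
GPC-strength — an additive invariant of `FormalRep` killing 1a/1b/3 and all signed-degree relators
but separating two equal-volume bodies (= ¬summit by `closes`); no such invariant is known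
(volume is the only known KZ-invariant of compact bodies, CressonViusos2022 §1). Sources:
CressonViusos2022 (§1 Conjecture p. 326, Prop. 3.2), ViuSos2021 Thm. 1.1, KontsevichZagier2001 §1.2,
`Literature.NumberTheory.Transcendental.KZ.volumeConjectureCompact`. Size: open-problem. -/
theorem stub_foldedVolumeKernel : ∀ ⦃d : ℕ⦄ (A B : KZ.IntegralRep d),
    IsCompact A.domain → (interior A.domain).Nonempty →
    IsCompact B.domain → (interior B.domain).Nonempty →
    (∀ x ∈ A.domain, A.integrand x = 1) → (∀ x ∈ B.domain, B.integrand x = 1) →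
    A.value = B.value → KZ.of A - KZ.of B ∈ enlargedRelations := by
  sorry

/-! ## The composition (sorry-free) -/

/-- `KZ.relations ≤ R'` from stub 1: the three shared generating sets embed literally and rule (2)
through the one-sheet relators. [cite: KontsevichZagier2001, §1.2] -/
theorem relations_le_enlargedRelations (hone : KZ.changeOfVariablesRel ⊆ degreeRel) :
    KZ.relations ≤ enlargedRelations := by
  refine (AddSubgroup.closure_le _).mpr ?_
  rintro x (((hx | hx) | hx) | hx)
  · exact AddSubgroup.subset_closure (Or.inl (Or.inl (Or.inl hx)))
  · exact AddSubgroup.subset_closure (Or.inl (Or.inl (Or.inr hx)))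
  · exact AddSubgroup.subset_closure (Or.inr (hone hx))
  · exact AddSubgroup.subset_closure (Or.inl (Or.inr hx))

/-- The composition, arrow form: ONE-SHEET ABSORPTION → FOLDED VOLUME KERNEL → the crux (UNFOLDED,
so that exactly one theorem of this file, `DegreeKernel_of`, concludes the crux by name). Given
`eval c = 0`: `c ≡ [r] − [r']` modulo KZ relations (`KZ.exists_integralRep_sub_holds`), soundness
gives `value r = value r'`; Viu-Sos' semi-canonical reduction (LANDED, `KZ.semiCanonicalReduction_holds`)
writes `[r] ≡ [A] − [B]`, `[r'] ≡ [A'] − [B']` with volume representations, raised to one dimension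
and glued `M₁ ≡ [A] + [B']`, `M₂ ≡ [A'] + [B]` (landed slab/glue lemmas); by soundness
`vol M₁ = vol M₂`, the folded volume kernel gives `[M₁] − [M₂] ∈ R'`, every KZ relation used on the
way lies in `R'` by one-sheet absorption, and bookkeeping in the free abelian group returns `c ∈ R'`.
(The skeleton of the argument is the tree's `KZ.kzPeriodConjecture'_of_volumeConjectureCompact`,
re-targeted at `R'`.) [cite: CressonViusos2022, §1 p. 326] -/
theorem degreeKernel_of_stubs
    (hone : KZ.changeOfVariablesRel ⊆ degreeRel)
    (hvol : ∀ ⦃d : ℕ⦄ (A B : KZ.IntegralRep d),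
      IsCompact A.domain → (interior A.domain).Nonempty →
      IsCompact B.domain → (interior B.domain).Nonempty →
      (∀ x ∈ A.domain, A.integrand x = 1) → (∀ x ∈ B.domain, B.integrand x = 1) →
      A.value = B.value → KZ.of A - KZ.of B ∈ enlargedRelations) :
    ∀ c : KZ.FormalRep, KZ.eval c = 0 → c ∈ enlargedRelations := by
  have hle : KZ.relations ≤ enlargedRelations := relations_le_enlargedRelations hone
  intro c hc
  -- `c ≡ [r] − [r']` modulo KZ relations, and `value r = value r'` by soundness
  obtain ⟨n, m, r, r', hrel⟩ := KZ.exists_integralRep_sub_holds c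
  have hval : r.value = r'.value := by
    have hker : KZ.eval (c - (KZ.of r - KZ.of r')) = 0 := KZ.relations_le_ker_eval_holds hrel
    rw [map_sub, hc, zero_sub, neg_eq_zero, KZ.eval_of_sub_of, sub_eq_zero] at hker
    exact hker
  -- Viu-Sos: `[r] ≡ [A] − [B]`, `[r'] ≡ [A'] − [B']` with volume representations
  obtain ⟨D, A, B, ⟨hAc, hAi, hA1⟩, ⟨hBc, hBi, hB1⟩, hrAB⟩ :=
    KZ.IntegralRep.exists_sub_volumeRep_mem_relations_of_semiCanonicalReduction
      KZ.semiCanonicalReduction_holds r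
  obtain ⟨D', A', B', ⟨hA'c, hA'i, hA'1⟩, ⟨hB'c, hB'i, hB'1⟩, hr'AB⟩ :=
    KZ.IntegralRep.exists_sub_volumeRep_mem_relations_of_semiCanonicalReduction
      KZ.semiCanonicalReduction_holds r'
  -- raise the four volume representations to the common dimension `max D D'`
  obtain ⟨A₁, hA₁c, hA₁i, hA₁1, hAA₁⟩ :=
    A.exists_volumeRep_equivalent_of_le hAc hAi hA1 (le_max_left D D')
  obtain ⟨B₁, hB₁c, hB₁i, hB₁1, hBB₁⟩ :=
    B.exists_volumeRep_equivalent_of_le hBc hBi hB1 (le_max_left D D')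
  obtain ⟨A₁', hA₁'c, hA₁'i, hA₁'1, hAA₁'⟩ :=
    A'.exists_volumeRep_equivalent_of_le hA'c hA'i hA'1 (le_max_right D D')
  obtain ⟨B₁', hB₁'c, hB₁'i, hB₁'1, hBB₁'⟩ :=
    B'.exists_volumeRep_equivalent_of_le hB'c hB'i hB'1 (le_max_right D D')
  -- glue `A₁ ⊔ B₁'` and `A₁' ⊔ B₁`
  obtain ⟨M₁, hM₁c, hM₁i, hM₁1, hM₁⟩ :=
    A₁.exists_volumeRep_of_add_sub_of_mem_relations B₁' hA₁c hA₁i hA₁1 hB₁'c hB₁'1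
  obtain ⟨M₂, hM₂c, hM₂i, hM₂1, hM₂⟩ :=
    A₁'.exists_volumeRep_of_add_sub_of_mem_relations B₁ hA₁'c hA₁'i hA₁'1 hB₁c hB₁1
  -- the two glued bodies have the same volume (soundness of the KZ moves)
  have hvolEq : M₁.value = M₂.value := by
    have e₁ := KZ.eval_eq_zero_of_mem_relations hrAB
    have e₂ := KZ.eval_eq_zero_of_mem_relations hr'AB
    have e₃ := KZ.eval_eq_zero_of_mem_relations hM₁
    have e₄ := KZ.eval_eq_zero_of_mem_relations hM₂
    simp only [map_sub, map_add, KZ.eval_of] at e₁ e₂ e₃ e₄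
    have f₁ := KZ.Equivalent.value_eq_holds hAA₁
    have f₂ := KZ.Equivalent.value_eq_holds hBB₁
    have f₃ := KZ.Equivalent.value_eq_holds hAA₁'
    have f₄ := KZ.Equivalent.value_eq_holds hBB₁'
    linarith
  -- the folded volume kernel, and bookkeeping in the formal group
  have hM : KZ.of M₁ - KZ.of M₂ ∈ enlargedRelations :=
    hvol M₁ M₂ hM₁c hM₁i hM₂c hM₂i hM₁1 hM₂1 hvolEq
  have hrr' : KZ.of r - KZ.of r' ∈ enlargedRelations := by
    have : KZ.of r - KZ.of r' = (KZ.of r - (KZ.of A - KZ.of B)) - (KZ.of r' - (KZ.of A' - KZ.of B'))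
        + (KZ.of A - KZ.of A₁) - (KZ.of B - KZ.of B₁) - (KZ.of A' - KZ.of A₁') + (KZ.of B' - KZ.of B₁')
        + (KZ.of A₁ + KZ.of B₁' - KZ.of M₁) - (KZ.of A₁' + KZ.of B₁ - KZ.of M₂)
        + (KZ.of M₁ - KZ.of M₂) := by
      abel
    rw [this]
    refine add_mem (hle ?_) hM
    exact KZ.relations.sub_mem (KZ.relations.add_mem (KZ.relations.add_mem
      (KZ.relations.sub_mem (KZ.relations.sub_mem (KZ.relations.add_mem (KZ.relations.sub_mem hrAB hr'AB)
        hAA₁) hBB₁) hAA₁') hBB₁') hM₁) hM₂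
  have hc' : c = (c - (KZ.of r - KZ.of r')) + (KZ.of r - KZ.of r') := by abel
  rw [hc']
  exact add_mem (hle hrel) hrr'

/-- **The skeleton theorem** (concludes the crux BY NAME; sorries enter only through the two named
stubs `stub_oneSheet`, `stub_foldedVolumeKernel`). [cite: CressonViusos2022, §1 p. 326] -/
theorem DegreeKernel_of : DegreeKernel :=
  degreeKernel_iff.mpr (degreeKernel_of_stubs stub_oneSheet stub_foldedVolumeKernel)

end Summit.KontsevichZagierPeriods.KontsevichZagierPeriods.Cruxes.DegreeKernel.Birth

end
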